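import Mathlib
import Summits.Ventures.LatticeQCDFlow.TrivializingMaps.AcceptanceFootprint
import Summits.Ventures.LatticeQCDFlow.TrivializingMaps.LightConeClustering
import HarnessLib

/-!
# THEOREM Q′ — acceptance vs footprint for QUASI-LOCAL proposals; the acceptance ceiling (theory-1 row 90)

HONEST FRAMING (verbatim, theory-1 brief): exact (Metropolis-corrected) sampling algorithms for lattice
gauge theory; figures of merit are autocorrelation/cost numbers at stated couplings and volumes; no
continuum-physics claim.

THEOREM Q (row 88, `AcceptanceFootprint`) bounds the target's connected correlations beyond twice the
RANGE of a STRICTLY local proposal by `6 (1 - acc) a b`.  The sampler of record of this venture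
(`TruncatedWilsonFlowSampler`: the exact time-`1` flow `𝓕_1` of Lüscher's order-`N` truncated generator
`-∂S̃^{[N]}_t`, Metropolis-corrected) is NOT strictly local — it is quasi-local with the light cone of
THEOREM L (`TruncatedFlowLightCone`, lean-2 row 82: inputs agreeing on `linkBall (2(N+1)m) e₀` give
outputs at `e₀` within `η_m = 2n e^{c} c^m / m!`, `c = coneRate d n B β 1 N`, volume-free).  This file
proves the quasi-local version and reads it as an ACCEPTANCE CEILING.

* §1 `abs_sub_mul_le_three_of_defect`, `abs_cov_le_of_integralClose_of_cov_le`,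
  `abs_cov_le_of_meanAccept_of_cov_le` — the covariance transfer of row 88 with a factorisation DEFECT
  `δ` on the model side: `|Cov_π(A,B)| ≤ 6 (1 - acc) a b + δ`.
* §2 **THEOREM Q′** `Gauge.abs_cov_boltzmann_le_of_meanAccept_of_ballInfluence`: `G = SU(n)`, continuous
  action `S`, a measurable proposal map `Φ` with the `m`-ball influence bound `η` (Frobenius), push-forward
  density `q`, equilibrium acceptance `≥ acc`; bounded measurable link-Lipschitz observables (`ℓ_A` on
  `S_A`, `ℓ_B` on `S_B`) with supports more than `2m` apart in plaquette distance:
  `|Cov_π(A,B)| ≤ 6 (1 - acc) a b + 2 (ℓ_A b + a ℓ_B) η`; and the CEILING form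
  `Gauge.meanAccept_ceiling_of_ballInfluence`: `6ab · acc ≤ 6ab - |Cov_π(A,B)| + 2 (ℓ_A b + a ℓ_B) η`.
* §3 `Gauge.abs_cov_boltzmann_le_of_meanAccept_of_range_lipschitz` — consistency: a proposal of
  plaquette range `r` is the case `m = r`, `η = 0`, and Q′ returns THEOREM Q's `6 (1 - acc) a b`.

SCOPE.  This file is PROPOSAL-AGNOSTIC: any measurable map with a certified ball influence bound (Euler /
Runge–Kutta discretised flows, exact-time flows, or a trained map with a certified cone).  The
instantiation to the venture's sampler of record — the exact time-`t` flow of `-∂S̃^{[N]}_t`, whose ball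
light cone `η_m = 2n e^{ct}(ct)^m/m!` with the volume-free rate `c = coneRate d n B β T N` is lean-2's row 82
`truncatedFlow_lightCone_ball` — is lean-2's `TruncatedFlowAcceptanceFootprint` (announced first; HOME
INBOX l.3419), reached there through the truncated-flow expressivity barrier; feeding row 82's cone into
`Gauge.meanAccept_ceiling_of_ballInfluence` gives the same numbers.

READING (THEORY-1.md §28.7).  For a proposal whose influence tail `η_m` dies in `m` at fixed coupling and
architecture, the acceptance is capped by the TARGET's own connected correlations just beyond the distance
where the tail is negligible: `acc ≤ 1 - (|Cov_π|(2m+1) - (ℓ-terms)·η_m)/(6ab)` for every `m`; raising the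
cap towards `1` as the target's correlation length (lattice units) grows requires widening the cone — the
depth-vs-correlation-length law of rows 88/89 for quasi-local proposals.
NOT CLAIMED: any value of a correlation length or of a cone rate at a given `β`; existence of the density
`q` is a hypothesis (`hν`), as in row 88; no converse; nothing extensive in the volume.

References: Lüscher, Commun. Math. Phys. 293 (2010) 899 [Luscher2010Trivializing] §3; rows 82, 86, 88.
-/

namespace Summit.Ventures.LatticeQCDFlow.TrivializingMaps

open MeasureTheory Set
open scoped ENNReal NNReal

/-! ## §1. Covariance transfer with a factorisation defect -/

section Abstract

variable {X : Type*} [MeasurableSpace X]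

/-- The three-term covariance estimate of `FiniteRangeDecorrelation.abs_sub_mul_le_three` with the exact
factorisation `m' = α' β'` replaced by a DEFECT `|m' - α' β'| ≤ δ`: `|m - α β| ≤ 3 ε a b + δ`.
(Pure arithmetic.) [folklore] -/
theorem abs_sub_mul_le_three_of_defect {m α β m' α' β' ε a b δ : ℝ} (hm : |m - m'| ≤ ε * (a * b))
    (hα : |α - α'| ≤ ε * a) (hβ : |β - β'| ≤ ε * b) (hα' : |α'| ≤ a) (hβb : |β| ≤ b)
    (hfac : |m' - α' * β'| ≤ δ) : |m - α * β| ≤ 3 * ε * (a * b) + δ := by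
  have h1 : |α' - α| ≤ ε * a := by rwa [abs_sub_comm] at hα
  have h2 : |β' - β| ≤ ε * b := by rwa [abs_sub_comm] at hβ
  have t2 : |α'| * |β' - β| ≤ a * (ε * b) :=
    mul_le_mul hα' h2 (abs_nonneg _) ((abs_nonneg _).trans hα')
  have t3 : |α' - α| * |β| ≤ (ε * a) * b :=
    mul_le_mul h1 hβb (abs_nonneg _) ((abs_nonneg _).trans h1)
  have e : m - α * β = (m - m') + ((m' - α' * β') + (α' * (β' - β) + (α' - α) * β)) := by ring
  rw [e]
  have s1 := abs_add_le (m - m') ((m' - α' * β') + (α' * (β' - β) + (α' - α) * β))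
  have s2 := abs_add_le (m' - α' * β') (α' * (β' - β) + (α' - α) * β)
  have s3 := abs_add_le (α' * (β' - β)) ((α' - α) * β)
  rw [abs_mul, abs_mul] at s3
  linarith

/-- **PROPOSITION R (ε-version) with a model-side defect.**  If `π` is `ε`-close in the dual sense to a
probability law `ν` under which `|Cov_ν(A, B)| ≤ δ`, and `|A| ≤ a`, `|B| ≤ b` are measurable, then
`|Cov_π(A, B)| ≤ 3 ε a b + δ`. [ours] -/
theorem abs_cov_le_of_integralClose_of_cov_le (π ν : Measure X) [IsProbabilityMeasure π]
    [IsProbabilityMeasure ν] {ε : ℝ} (hclose : IntegralClose π ν ε) {A B : X → ℝ}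
    (hAm : Measurable A) (hBm : Measurable B) {a b : ℝ} (hA : ∀ x, |A x| ≤ a) (hB : ∀ x, |B x| ≤ b)
    {δ : ℝ} (hcov : |∫ x, A x * B x ∂ν - (∫ x, A x ∂ν) * ∫ x, B x ∂ν| ≤ δ) :
    |∫ x, A x * B x ∂π - (∫ x, A x ∂π) * ∫ x, B x ∂π| ≤ 3 * ε * (a * b) + δ := by
  obtain ⟨x₀⟩ : Nonempty X := nonempty_of_isProbabilityMeasure π
  have ha : 0 ≤ a := (abs_nonneg _).trans (hA x₀)
  have hb : 0 ≤ b := (abs_nonneg _).trans (hB x₀)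
  have hAB : ∀ x, |A x * B x| ≤ a * b := fun x => by
    rw [abs_mul]
    exact mul_le_mul (hA x) (hB x) (abs_nonneg _) ha
  have hmean : ∀ (μ : Measure X) [IsProbabilityMeasure μ] (f : X → ℝ) (c : ℝ),
      (∀ x, |f x| ≤ c) → |∫ x, f x ∂μ| ≤ c := by
    intro μ _ f c hf
    have h := norm_integral_le_of_norm_le_const (μ := μ) (f := f) (C := c)
      (Filter.Eventually.of_forall fun x => by simpa [Real.norm_eq_abs] using hf x)
    simpa [Real.norm_eq_abs] using h
  exact abs_sub_mul_le_three_of_defect (hclose _ _ (hAm.mul hBm) (mul_nonneg ha hb) hAB)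
    (hclose _ _ hAm ha hA) (hclose _ _ hBm hb hB) (hmean ν A a hA) (hmean π B b hB) hcov

variable {μ : Measure X} {p q : X → ℝ} [SFinite μ]

/-- **Acceptance `⟹` clustering transfer with a model-side defect (abstract).**  Target `p·μ`, model
`q·μ`, equilibrium acceptance of the independence sampler `≥ acc`, `|Cov_{q·μ}(A, B)| ≤ δ`:
`|Cov_{p·μ}(A, B)| ≤ 6 (1 - acc) a b + δ`. [ours] -/
theorem abs_cov_le_of_meanAccept_of_cov_le (hp0 : ∀ x, 0 ≤ p x) (hpm : Measurable p)
    (hpi : Integrable p μ) (hp1 : ∫ x, p x ∂μ = 1) (hq0 : ∀ x, 0 ≤ q x) (hqm : Measurable q)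
    (hqi : Integrable q μ) (hq1 : ∫ x, q x ∂μ = 1) {acc : ℝ}
    (hacc : acc ≤ ∫ x, ∫ y, min (p x * q y) (p y * q x) ∂μ ∂μ) {A B : X → ℝ} (hAm : Measurable A)
    (hBm : Measurable B) {a b : ℝ} (hA : ∀ x, |A x| ≤ a) (hB : ∀ x, |B x| ≤ b) {δ : ℝ}
    (hcov : |∫ x, A x * B x ∂(μ.withDensity fun x => ENNReal.ofReal (q x))
      - (∫ x, A x ∂(μ.withDensity fun x => ENNReal.ofReal (q x)))
        * ∫ x, B x ∂(μ.withDensity fun x => ENNReal.ofReal (q x))| ≤ δ) :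
    |∫ x, A x * B x ∂(μ.withDensity fun x => ENNReal.ofReal (p x))
        - (∫ x, A x ∂(μ.withDensity fun x => ENNReal.ofReal (p x)))
          * ∫ x, B x ∂(μ.withDensity fun x => ENNReal.ofReal (p x))|
      ≤ 6 * (1 - acc) * (a * b) + δ := by
  haveI := isProbabilityMeasure_withDensity_ofReal hp0 hpi hp1
  haveI := isProbabilityMeasure_withDensity_ofReal hq0 hqi hq1
  have h := abs_cov_le_of_integralClose_of_cov_le _ _
    (integralClose_of_meanAccept hp0 hpm hpi hp1 hq0 hqm hqi hq1 hacc) hAm hBm hA hB hcov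
  linarith

end Abstract

/-! ## §2. THEOREM Q′ — quasi-local proposals on `SU(n)` link fields -/

namespace Gauge

open Literature.MathematicalPhysics.QuantumFieldTheory
open Literature.MathematicalPhysics.QuantumFieldTheory.Luscher2010
open Literature.MathematicalPhysics.QuantumFieldTheory.WilsonFlow (coeConfig coeConfig_apply)
open scoped Matrix Matrix.Norms.Frobenius

variable {d L n : ℕ} [NeZero L]

/-- **THEOREM Q′ (acceptance vs. footprint for a quasi-local proposal).**  `G = SU(n)`, continuous action
`S`, target `π = 𝒵⁻¹ e^{-S} D[U]`; a measurable proposal map `Φ` with the `m`-BALL INFLUENCE BOUND `η ≥ 0`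
(inputs agreeing on `linkBall m e₀` give outputs at `e₀` within `η` in Frobenius norm) whose push-forward
`Φ_* D[V]` has density `q ≥ 0`; the independence Metropolis sampler on it has equilibrium acceptance
`≥ acc`.  Then for bounded measurable observables `|A| ≤ a`, `|B| ≤ b`, link-Lipschitz with constants
`ℓ_A` on `S_A`, `ℓ_B` on `S_B`, and supports at plaquette distance `> 2m`:
`|⟨A B⟩ - ⟨A⟩⟨B⟩| ≤ 6 (1 - acc) a b + 2 (ℓ_A b + a ℓ_B) η` (expectations in `π`). [ours] -/
theorem abs_cov_boltzmann_le_of_meanAccept_of_ballInfluence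
    {S : GaugeConfig d L (Matrix.specialUnitaryGroup (Fin n) ℂ) → ℝ} (hS : Continuous S)
    {Φ : GaugeConfig d L (Matrix.specialUnitaryGroup (Fin n) ℂ) →
      GaugeConfig d L (Matrix.specialUnitaryGroup (Fin n) ℂ)} (hΦm : Measurable Φ) {m : ℕ} {η : ℝ}
    (hη : 0 ≤ η)
    (hcone : ∀ (e₀ : Edge d L) (V V' : GaugeConfig d L (Matrix.specialUnitaryGroup (Fin n) ℂ)),
      (∀ e ∈ linkBall m e₀, V e = V' e) → ‖coeConfig (Φ V) e₀ - coeConfig (Φ V') e₀‖ ≤ η)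
    {q : GaugeConfig d L (Matrix.specialUnitaryGroup (Fin n) ℂ) → ℝ} (hq0 : ∀ U, 0 ≤ q U)
    (hqm : Measurable q)
    (hν : (trivialMeasure (Matrix.specialUnitaryGroup (Fin n) ℂ) d L).map Φ
      = (trivialMeasure (Matrix.specialUnitaryGroup (Fin n) ℂ) d L).withDensity
          fun U => ENNReal.ofReal (q U))
    {acc : ℝ}
    (hacc : acc ≤ ∫ U, ∫ U', min (Real.exp (-S U) / (partitionFn S).toReal * q U')
        (Real.exp (-S U') / (partitionFn S).toReal * q U)
        ∂(trivialMeasure (Matrix.specialUnitaryGroup (Fin n) ℂ) d L)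
        ∂(trivialMeasure (Matrix.specialUnitaryGroup (Fin n) ℂ) d L))
    {A B : GaugeConfig d L (Matrix.specialUnitaryGroup (Fin n) ℂ) → ℝ} (hAm : Measurable A)
    (hBm : Measurable B) {a b ℓA ℓB : ℝ} (hAa : ∀ U, |A U| ≤ a) (hBb : ∀ U, |B U| ≤ b)
    {SA SB : Set (Edge d L)}
    (hAlip : ∀ (U U' : GaugeConfig d L (Matrix.specialUnitaryGroup (Fin n) ℂ)) (η' : ℝ), 0 ≤ η' →
      (∀ e ∈ SA, ‖coeConfig U e - coeConfig U' e‖ ≤ η') → |A U - A U'| ≤ ℓA * η')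
    (hBlip : ∀ (U U' : GaugeConfig d L (Matrix.specialUnitaryGroup (Fin n) ℂ)) (η' : ℝ), 0 ≤ η' →
      (∀ e ∈ SB, ‖coeConfig U e - coeConfig U' e‖ ≤ η') → |B U - B U'| ≤ ℓB * η')
    (hsep : ∀ e ∈ SA, ∀ e' ∈ SB, e' ∉ linkBall (2 * m) e) :
    |∫ U, A U * B U ∂(boltzmannMeasure S)
        - (∫ U, A U ∂(boltzmannMeasure S)) * ∫ U, B U ∂(boltzmannMeasure S)|
      ≤ 6 * (1 - acc) * (a * b) + 2 * (ℓA * b + a * ℓB) * η := by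
  classical
  haveI : IsProbabilityMeasure (trivialMeasure (Matrix.specialUnitaryGroup (Fin n) ℂ) d L) := by
    unfold trivialMeasure; infer_instance
  -- the freeze approximant of `Φ` (as in THEOREM C): read the ball, freeze the rest to the unit field
  set V₀ : GaugeConfig d L (Matrix.specialUnitaryGroup (Fin n) ℂ) := fun _ => 1 with hV₀
  set Ψ : GaugeConfig d L (Matrix.specialUnitaryGroup (Fin n) ℂ) →
      GaugeConfig d L (Matrix.specialUnitaryGroup (Fin n) ℂ) :=
    fun V e => Φ ((linkBall m e).piecewise V V₀) e with hΨ_def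
  have hΨ : ∀ e, DependsOn (fun W => Ψ W e) (linkBall m e) := by
    intro e V V' h
    have hp : (linkBall m e).piecewise V V₀ = (linkBall m e).piecewise V' V₀ :=
      dependsOn_piecewise_config (linkBall m e) V₀ h
    simp only [hΨ_def, hp]
  have hΨm : Measurable Ψ :=
    measurable_pi_iff.2 fun e =>
      (measurable_pi_apply e).comp (hΦm.comp (measurable_piecewise_config (linkBall m e) V₀))
  have hδ : ∀ V e, ‖coeConfig (Φ V) e - coeConfig (Ψ V) e‖ ≤ η := by
    intro V e
    have h := hcone e V ((linkBall m e).piecewise V V₀)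
      (fun e' he' => (piecewise_config_eq_of_mem (linkBall m e) V V₀ he').symm)
    simpa only [coeConfig_apply, hΨ_def] using h
  have hδA : ∀ V, |A (Φ V) - A (Ψ V)| ≤ ℓA * η := fun V => hAlip _ _ η hη fun e _ => hδ V e
  have hδB : ∀ V, |B (Φ V) - B (Ψ V)| ≤ ℓB * η := fun V => hBlip _ _ η hη fun e _ => hδ V e
  -- the model-side covariance bound under `Φ_* D[V]`
  have key : |∫ U, A U * B U ∂(trivialMeasure (Matrix.specialUnitaryGroup (Fin n) ℂ) d L).map Φ -
      (∫ U, A U ∂(trivialMeasure (Matrix.specialUnitaryGroup (Fin n) ℂ) d L).map Φ) *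
        ∫ U, B U ∂(trivialMeasure (Matrix.specialUnitaryGroup (Fin n) ℂ) d L).map Φ|
      ≤ 2 * (ℓA * η * b + a * (ℓB * η)) :=
    abs_cov_pushforward_le_of_approx_of_disjoint
      (haarProbability (Matrix.specialUnitaryGroup (Fin n) ℂ)) hΦm hΨm hΨ hAm hBm hAa hBb
      (dependsOn_of_linkLipschitz hAlip) (dependsOn_of_linkLipschitz hBlip)
      (disjoint_readClosure_linkBall hsep) hδA hδB
  rw [hν] at key
  -- the acceptance transfer of row 88, with the defect
  obtain ⟨hp0, hpm, hpi, hp1⟩ := density_boltzmann_spec (d := d) (L := L) hS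
  obtain ⟨hqi, hq1⟩ := integrable_of_map_eq_withDensity (d := d) (L := L) hΦm hq0 hqm hν
  rw [boltzmannMeasure_eq_withDensity hS]
  have h := abs_cov_le_of_meanAccept_of_cov_le hp0 hpm hpi hp1 hq0 hqm hqi hq1 hacc hAm hBm hAa hBb
    key
  calc _ ≤ 6 * (1 - acc) * (a * b) + 2 * (ℓA * η * b + a * (ℓB * η)) := h
    _ = 6 * (1 - acc) * (a * b) + 2 * (ℓA * b + a * ℓB) * η := by ring

/-- **ACCEPTANCE CEILING (quasi-local proposal).**  Same hypotheses, rearranged (division-free):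
`6ab · acc ≤ 6ab - |Cov_π(A, B)| + 2 (ℓ_A b + a ℓ_B) η` — i.e. for `ab > 0`,
`acc ≤ 1 - (|Cov_π(A, B)| - 2 (ℓ_A b + a ℓ_B) η) / (6ab)`: a proposal that moves each link by at most `η`
when its `m`-ball is frozen cannot be accepted more often than the target's own correlations beyond
plaquette distance `2m` allow. [ours] -/
theorem meanAccept_ceiling_of_ballInfluence
    {S : GaugeConfig d L (Matrix.specialUnitaryGroup (Fin n) ℂ) → ℝ} (hS : Continuous S)
    {Φ : GaugeConfig d L (Matrix.specialUnitaryGroup (Fin n) ℂ) →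
      GaugeConfig d L (Matrix.specialUnitaryGroup (Fin n) ℂ)} (hΦm : Measurable Φ) {m : ℕ} {η : ℝ}
    (hη : 0 ≤ η)
    (hcone : ∀ (e₀ : Edge d L) (V V' : GaugeConfig d L (Matrix.specialUnitaryGroup (Fin n) ℂ)),
      (∀ e ∈ linkBall m e₀, V e = V' e) → ‖coeConfig (Φ V) e₀ - coeConfig (Φ V') e₀‖ ≤ η)
    {q : GaugeConfig d L (Matrix.specialUnitaryGroup (Fin n) ℂ) → ℝ} (hq0 : ∀ U, 0 ≤ q U)
    (hqm : Measurable q)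
    (hν : (trivialMeasure (Matrix.specialUnitaryGroup (Fin n) ℂ) d L).map Φ
      = (trivialMeasure (Matrix.specialUnitaryGroup (Fin n) ℂ) d L).withDensity
          fun U => ENNReal.ofReal (q U))
    {acc : ℝ}
    (hacc : acc ≤ ∫ U, ∫ U', min (Real.exp (-S U) / (partitionFn S).toReal * q U')
        (Real.exp (-S U') / (partitionFn S).toReal * q U)
        ∂(trivialMeasure (Matrix.specialUnitaryGroup (Fin n) ℂ) d L)
        ∂(trivialMeasure (Matrix.specialUnitaryGroup (Fin n) ℂ) d L))
    {A B : GaugeConfig d L (Matrix.specialUnitaryGroup (Fin n) ℂ) → ℝ} (hAm : Measurable A)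
    (hBm : Measurable B) {a b ℓA ℓB : ℝ} (hAa : ∀ U, |A U| ≤ a) (hBb : ∀ U, |B U| ≤ b)
    {SA SB : Set (Edge d L)}
    (hAlip : ∀ (U U' : GaugeConfig d L (Matrix.specialUnitaryGroup (Fin n) ℂ)) (η' : ℝ), 0 ≤ η' →
      (∀ e ∈ SA, ‖coeConfig U e - coeConfig U' e‖ ≤ η') → |A U - A U'| ≤ ℓA * η')
    (hBlip : ∀ (U U' : GaugeConfig d L (Matrix.specialUnitaryGroup (Fin n) ℂ)) (η' : ℝ), 0 ≤ η' →
      (∀ e ∈ SB, ‖coeConfig U e - coeConfig U' e‖ ≤ η') → |B U - B U'| ≤ ℓB * η')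
    (hsep : ∀ e ∈ SA, ∀ e' ∈ SB, e' ∉ linkBall (2 * m) e) :
    6 * (a * b) * acc ≤ 6 * (a * b)
      - |∫ U, A U * B U ∂(boltzmannMeasure S)
          - (∫ U, A U ∂(boltzmannMeasure S)) * ∫ U, B U ∂(boltzmannMeasure S)|
      + 2 * (ℓA * b + a * ℓB) * η := by
  have h := abs_cov_boltzmann_le_of_meanAccept_of_ballInfluence hS hΦm hη hcone hq0 hqm hν hacc hAm hBm
    hAa hBb hAlip hBlip hsep
  linarith

/-! ## §3. Consistency with THEOREM Q: a strictly local proposal is the case `η = 0` -/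

/-- **Q′ contains Q (plaquette-ball form) for link-Lipschitz observables.**  If the proposal map has
plaquette RANGE `r` (output link `e` reads only `linkBall r e`), the `r`-ball influence bound holds with
`η = 0`, and THEOREM Q′ returns row 89's bound `|Cov_π(A, B)| ≤ 6 (1 - acc) a b` beyond `2r` — the
hypotheses of Q′ are inhabited whenever those of THEOREM Q are. [ours] -/
theorem abs_cov_boltzmann_le_of_meanAccept_of_range_lipschitz
    {S : GaugeConfig d L (Matrix.specialUnitaryGroup (Fin n) ℂ) → ℝ} (hS : Continuous S)
    {Φ : GaugeConfig d L (Matrix.specialUnitaryGroup (Fin n) ℂ) →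
      GaugeConfig d L (Matrix.specialUnitaryGroup (Fin n) ℂ)} (hΦm : Measurable Φ) {r : ℕ}
    (hΦ : ∀ e, DependsOn (fun W => Φ W e) (linkBall r e))
    {q : GaugeConfig d L (Matrix.specialUnitaryGroup (Fin n) ℂ) → ℝ} (hq0 : ∀ U, 0 ≤ q U)
    (hqm : Measurable q)
    (hν : (trivialMeasure (Matrix.specialUnitaryGroup (Fin n) ℂ) d L).map Φ
      = (trivialMeasure (Matrix.specialUnitaryGroup (Fin n) ℂ) d L).withDensity
          fun U => ENNReal.ofReal (q U))
    {acc : ℝ}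
    (hacc : acc ≤ ∫ U, ∫ U', min (Real.exp (-S U) / (partitionFn S).toReal * q U')
        (Real.exp (-S U') / (partitionFn S).toReal * q U)
        ∂(trivialMeasure (Matrix.specialUnitaryGroup (Fin n) ℂ) d L)
        ∂(trivialMeasure (Matrix.specialUnitaryGroup (Fin n) ℂ) d L))
    {A B : GaugeConfig d L (Matrix.specialUnitaryGroup (Fin n) ℂ) → ℝ} (hAm : Measurable A)
    (hBm : Measurable B) {a b ℓA ℓB : ℝ} (hAa : ∀ U, |A U| ≤ a) (hBb : ∀ U, |B U| ≤ b)
    {SA SB : Set (Edge d L)}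
    (hAlip : ∀ (U U' : GaugeConfig d L (Matrix.specialUnitaryGroup (Fin n) ℂ)) (η' : ℝ), 0 ≤ η' →
      (∀ e ∈ SA, ‖coeConfig U e - coeConfig U' e‖ ≤ η') → |A U - A U'| ≤ ℓA * η')
    (hBlip : ∀ (U U' : GaugeConfig d L (Matrix.specialUnitaryGroup (Fin n) ℂ)) (η' : ℝ), 0 ≤ η' →
      (∀ e ∈ SB, ‖coeConfig U e - coeConfig U' e‖ ≤ η') → |B U - B U'| ≤ ℓB * η')
    (hsep : ∀ e ∈ SA, ∀ e' ∈ SB, e' ∉ linkBall (2 * r) e) :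
    |∫ U, A U * B U ∂(boltzmannMeasure S)
        - (∫ U, A U ∂(boltzmannMeasure S)) * ∫ U, B U ∂(boltzmannMeasure S)|
      ≤ 6 * (1 - acc) * (a * b) := by
  have hcone : ∀ (e₀ : Edge d L) (V V' : GaugeConfig d L (Matrix.specialUnitaryGroup (Fin n) ℂ)),
      (∀ e ∈ linkBall r e₀, V e = V' e) → ‖coeConfig (Φ V) e₀ - coeConfig (Φ V') e₀‖ ≤ 0 := by
    intro e₀ V V' h
    rw [coeConfig_apply, coeConfig_apply, show Φ V e₀ = Φ V' e₀ from hΦ e₀ h, sub_self, norm_zero]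
  have h := abs_cov_boltzmann_le_of_meanAccept_of_ballInfluence hS hΦm le_rfl hcone hq0 hqm hν hacc hAm
    hBm hAa hBb hAlip hBlip hsep
  linarith

end Gauge

end Summit.Ventures.LatticeQCDFlow.TrivializingMaps
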